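import Mathlib
import HarnessLib
import Summits.ValiantsHypothesis.ValiantsHypothesis.Theses.MonotoneRestoration
import Literature.Computability.AlgebraicComplexity.ArithCircuit
import Literature.Computability.AlgebraicComplexity.ArithCircuitProofs
import Literature.Computability.AlgebraicComplexity.MonotoneStructure
import Literature.Computability.AlgebraicComplexity.PermanentIrreducible
import Literature.ModelTheory.FiniteModelTheory.CkEquiv
import Summits.ValiantsHypothesis.ValiantsHypothesis.Theorems.MonotoneRestorationMonotoneRestorationQPCosetCount
import Summits.ValiantsHypothesis.ValiantsHypothesis.Theorems.MonotoneRestorationMonotoneRestorationQPSymmetricLB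
import Summits.ValiantsHypothesis.ValiantsHypothesis.Theorems.MonotoneRestorationMonotoneRestorationQPSupportSymmetrisation
import Summits.ValiantsHypothesis.ValiantsHypothesis.Theorems.MonotoneRestorationMonotoneRestorationQPSparseRegime
import Summits.ValiantsHypothesis.ValiantsHypothesis.Theorems.MonotoneRestorationMonotoneRestorationQPBeta
import Literature.Computability.AlgebraicComplexity.SymmetricArithCircuit
import Literature.Computability.AlgebraicComplexity.DawarWilsenach2025Proofs
import Literature.GroupTheory.PermutationGroups.SmallIndexSubgroups
import Summits.ValiantsHypothesis.ValiantsHypothesis.Theorems.MonotoneRestorationQP.Negative.LoadBearing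
import Summits.ValiantsHypothesis.ValiantsHypothesis.Theorems.MonotoneRestorationMonotoneRestorationQPPermSupportCount

/-! TTRL-lite variant V18931 of stmt-ValiantsHypothesis-15886 -/

-- `Summit.ValiantsHypothesis.ValiantsHypothesis.…` is the tree's mandated single-conjunct layout
-- (Sub = Summit), so the duplicated namespace component is intended.
set_option linter.dupNamespace false

namespace Summit.ValiantsHypothesis.ValiantsHypothesis.Theorems

open Summit.ValiantsHypothesis.ValiantsHypothesis.Theses.MonotoneRestoration
open Literature.Computability.AlgebraicComplexity

/-- **TTRL-lite variant V18931** (`generalise`, boundary probe) of `stub_mulGate_children_extend`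
(item `stmt-ValiantsHypothesis-15886`) is FALSE: one may NOT keep the same shift `μ` for a factor
`p` that worked for the product `p * q` — the child's shift has to absorb a monomial of the
cofactor `q`.  Witness (one variable `v = (0,0)`): `p = q = X v`, `f = p * q = X v ^ 2`, `μ = 0`;
the product hypothesis holds trivially, but `m = single v 1 ∈ p.support` while
`single v 1 ∉ (X v ^ 2).support = {single v 2}`. -/
theorem stub_mulGate_children_extend_var18931_false :
    ¬ (∀ (p q f : MvPolynomial (Fin 1 × Fin 1) NNReal) (μ : (Fin 1 × Fin 1) →₀ ℕ),
        p * q ≠ 0 → (∀ m ∈ (p * q).support, m + μ ∈ f.support) →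
        ∀ m ∈ p.support, m + μ ∈ f.support) := by
  intro h
  -- the witness: `p = q = X v`, `f = p * q = X v ^ 2`, `μ = 0`, `m = single v 1`, `v = (0, 0)`
  have hpq : (MvPolynomial.X ((0, 0) : Fin 1 × Fin 1) : MvPolynomial (Fin 1 × Fin 1) NNReal) *
      MvPolynomial.X (0, 0) = MvPolynomial.monomial (Finsupp.single (0, 0) 2) 1 := by
    rw [← sq, MvPolynomial.X_pow_eq_monomial]
  have hne : (MvPolynomial.X ((0, 0) : Fin 1 × Fin 1) : MvPolynomial (Fin 1 × Fin 1) NNReal) *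
      MvPolynomial.X (0, 0) ≠ 0 := by
    rw [hpq]
    exact (MvPolynomial.monomial_eq_zero).not.mpr one_ne_zero
  have hm : Finsupp.single ((0, 0) : Fin 1 × Fin 1) 1 ∈
      (MvPolynomial.X ((0, 0) : Fin 1 × Fin 1) : MvPolynomial (Fin 1 × Fin 1) NNReal).support := by
    rw [MvPolynomial.support_X]
    exact Finset.mem_singleton_self _
  have key := h (MvPolynomial.X (0, 0)) (MvPolynomial.X (0, 0))
    (MvPolynomial.X (0, 0) * MvPolynomial.X (0, 0)) 0 hne
    (fun m hm' => by rwa [add_zero]) (Finsupp.single (0, 0) 1) hm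
  rw [add_zero, hpq, MvPolynomial.mem_support_iff, MvPolynomial.coeff_monomial] at key
  have h21 : Finsupp.single ((0, 0) : Fin 1 × Fin 1) 2 ≠ Finsupp.single ((0, 0) : Fin 1 × Fin 1) 1 := by
    intro h21
    have := Finsupp.single_injective ((0, 0) : Fin 1 × Fin 1) h21
    omega
  exact key (if_neg h21)

end Summit.ValiantsHypothesis.ValiantsHypothesis.Theorems
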